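import Summits.QuantumFields.YangMills.Theorems.CovariantDischargeCombSweepCostRows
import HarnessLib

/-!
# Line «sandwich_discharge» on crux `HistoryTailL` (stmt-QuantumFields-19936), stub `stub_sandwichSweepGapCapped` — GLUE-KNIT:
# THE DOOR'S `hGLUE` IN THE PROFILE'S LETTERS — signal functional minus closed-form cost ≤ action drop

Cell `ym3-torus` (YM ladder rung R3 = continuum SU(2) Yang–Mills on the three-torus — a RUNG, NOT the Clay problem: not d = 4, not
infinite volume, not a mass gap), width seat `ym-ust-19936-w5` gen 14, helper letters `--supports stmt-QuantumFields-19936`.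

WHY.  The door skeleton of record (px8 g7 v3 f02daf0d) sweeps with amplitude `cb := s·aT` (`aT` the profile of
✓`CovariantDischargeProfileSocket.exists_profile_socket`, vanishing off the swept set `S`), and its leaf `hGLUE` wants
`SIG − REST ≤ A(V) − A(Ψ′V)` with `SIG := Σ_q s·(aT(b₁)+aT(b₂)−aT(b₃)−aT(b₄))·⟨v, imVec su2Quat((V^{axialT V c₀})(∂q))⟩` and an explicit `REST`.
This file instantiates ✓`CovariantDischargeCombSweepCostRows.comb_signal_sub_cost_le_wilsonAction4_sub_sweepInv` at `τ := s·A_T`, `M₁ := s·M_L`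
and rewrites its signal and its `Σ_q s_q²` in the profile's letters:
* `signed_eq` — with `aT = 0` off `S`, the signed amplitude `c_b = (if b ∈ S then −s·aT_b else 0)` is `−s·aT_b` everywhere;
* `sum_neg_bondSum_mul_eq` — `Σ_q (−s_q)·F_q = Σ_q s·(aT b₁ + aT b₂ − aT b₃ − aT b₄)·F_q` (= the door's `SIG`);
* `sum_bondSum_sq_eq` — `Σ_q s_q² = (s²∕2)·Σ_x Σ_a Σ_b (d₁aT)(x,a,b)²` (✓`CovariantDischargePlaqPairSum.sum_curl_sq_eq_two_mul_sum_plaq`);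
* ★★★ `profile_signal_sub_cost_le_wilsonAction4_sub_sweepInv` — for `0 ≤ s`, `|aT_b| ≤ A_T`, `Σ_b|aT_b| ≤ M_L`, `Σ_xab (d₁aT)² ≤ Q`, `s·A_T ≤ 1∕4`:
  `SIG − [(3∕4)s²Q + θ·d·(sM_L)·(2(4sA_T+4η+θ) + 176sA_T) + (3∕2)·d·(sM_L)·((8(sA_T)²+2sA_T(4η+θ))·2(4sA_T+4η+θ) + 30976(sA_T)³)] ≤ A(V) − A(Ψ′V)`,
  `η := ((2d(r+1)+2)²∕4)·θ` — so the door takes `REST :=` the bracket and is left with `REST ≤ sθ∕16 + Bc·L^j·s²` (the exponent rows).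
HONEST SCOPE: deterministic per-configuration algebra; nothing of the profile's construction, the signal lower bound, the exponent rows,
`stub_sandwichSweepGapCapped`, `HistoryTailL` or any summit statement is proved or claimed. [cite: Balaban1985Averaging, (10) p.19, (19)-(20) p.21, p.24; Balaban1987RG1, (0.2) p.252]
-/

noncomputable section

open scoped BigOperators RealInnerProductSpace
open Literature.MathematicalPhysics.QuantumLattice (su2Quat)
open Literature.MathematicalPhysics.QuantumFieldTheory.Balaban1983to89
open Literature.MathematicalPhysics.QuantumFieldTheory.Balaban1983to89.T4CubeChartGnomonic (SU2)
open Literature.MathematicalPhysics.QuantumFieldTheory.Balaban1983to89.T4HaarSU2ExpChart (expPoint)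
open Literature.MathematicalPhysics.QuantumFieldTheory.Balaban1983to89.T4ExpWindowSmallField (imVec)
open Literature.MathematicalPhysics.QuantumFieldTheory.Balaban1983to89.T4WilsonLinkAffine (bond₁ bond₂ bond₃ bond₄)
open Literature.MathematicalPhysics.QuantumFieldTheory.Balaban1983to89.B15Prop1ChartSU2 (adSU2)
open Literature.MathematicalPhysics.QuantumFieldTheory.Balaban1983to89.B10Eq27TorusAxialLog (transl axialT)
open Summit.QuantumFields.YangMills.Theorems.CovariantDischargePlaqPairSum (sum_curl_sq_eq_two_mul_sum_plaq)
open Summit.QuantumFields.YangMills.Theorems.CovariantDischargeCombSweepCostRows (comb_signal_sub_cost_le_wilsonAction4_sub_sweepInv)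

namespace Summit.QuantumFields.YangMills.Theorems.CovariantDischargeCombSweepProfileGlue

variable {P : Params} {k : ℕ} [DecidableEq (PBond P k)]

/-- With `aT = 0` off `S`, the signed amplitude of the sweep's undoing is `−s·aT` everywhere. [folklore] -/
theorem signed_eq (S : Finset (PBond P k)) (aT : PBond P k → ℝ) (haTS : ∀ b, b ∉ S → aT b = 0) (s : ℝ) (b : PBond P k) :
    (if b ∈ S then -(s * aT b) else 0) = -(s * aT b) := by
  by_cases h : b ∈ S
  · rw [if_pos h]
  · rw [if_neg h, haTS b h, mul_zero, neg_zero]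

/-- `Σ_q (−s_q)·F_q = Σ_q s·(aT b₁ + aT b₂ − aT b₃ − aT b₄)·F_q` for the signed amplitude of `signed_eq`. [folklore] -/
theorem sum_neg_bondSum_mul_eq (S : Finset (PBond P k)) (aT : PBond P k → ℝ) (haTS : ∀ b, b ∉ S → aT b = 0) (s : ℝ)
    (F sq : Plaq P k → ℝ)
    (hs : ∀ q, sq q = (if bond₁ q ∈ S then -(s * aT (bond₁ q)) else 0) + (if bond₂ q ∈ S then -(s * aT (bond₂ q)) else 0) -
        (if bond₃ q ∈ S then -(s * aT (bond₃ q)) else 0) - (if bond₄ q ∈ S then -(s * aT (bond₄ q)) else 0)) :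
    ∑ q : Plaq P k, -sq q * F q =
      ∑ q : Plaq P k, s * (aT (bond₁ q) + aT (bond₂ q) - aT (bond₃ q) - aT (bond₄ q)) * F q := by
  refine Finset.sum_congr rfl fun q _ => ?_
  rw [hs q, signed_eq S aT haTS, signed_eq S aT haTS, signed_eq S aT haTS, signed_eq S aT haTS]
  ring

/-- `Σ_q s_q² = (s²∕2)·Σ_x Σ_a Σ_b (d₁aT)(x,a,b)²` for the signed amplitude of `signed_eq` (✓`sum_curl_sq_eq_two_mul_sum_plaq`).
[cite: Balaban1984PropagatorsI, (1.4) p.18 (bookkeeping)] -/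
theorem sum_bondSum_sq_eq (S : Finset (PBond P k)) (aT : PBond P k → ℝ) (haTS : ∀ b, b ∉ S → aT b = 0) (s : ℝ)
    (sq : Plaq P k → ℝ)
    (hs : ∀ q, sq q = (if bond₁ q ∈ S then -(s * aT (bond₁ q)) else 0) + (if bond₂ q ∈ S then -(s * aT (bond₂ q)) else 0) -
        (if bond₃ q ∈ S then -(s * aT (bond₃ q)) else 0) - (if bond₄ q ∈ S then -(s * aT (bond₄ q)) else 0)) :
    ∑ q : Plaq P k, sq q ^ 2 =
      s ^ 2 / 2 * ∑ x : Site P k, ∑ a : Fin P.d, ∑ b : Fin P.d,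
        ((aT ⟨x.shift a, b⟩ - aT ⟨x, b⟩) - (aT ⟨x.shift b, a⟩ - aT ⟨x, a⟩)) ^ 2 := by
  rw [sum_curl_sq_eq_two_mul_sum_plaq aT]
  have e : ∀ q : Plaq P k, sq q ^ 2 = s ^ 2 * (aT (bond₁ q) + aT (bond₂ q) - aT (bond₃ q) - aT (bond₄ q)) ^ 2 := fun q => by
    rw [hs q, signed_eq S aT haTS, signed_eq S aT haTS, signed_eq S aT haTS, signed_eq S aT haTS]
    ring
  rw [Finset.sum_congr rfl fun q (_ : q ∈ (Finset.univ : Finset (Plaq P k))) => e q, ← Finset.mul_sum]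
  ring

/-- ★★★ **THE DOOR'S `hGLUE`, ALGEBRAIC PART, IN THE PROFILE'S LETTERS.**  Sweep pair of ✓`exists_sweep_pair_comb` with amplitude
`cb := s·aT` (`aT = 0` off `S`, sources of `S` in the `r`-ball about `c₀`, `2(r+2) ≤` period), `0 ≤ s`, `|aT_b| ≤ A_T` (`0 ≤ A_T`), `Σ_b |aT_b| ≤ M_L`,
`Σ_xab (d₁aT)² ≤ Q`, `s·A_T ≤ 1∕4`, `PlaqSmall θ V`, `η := ((2d(r+1)+2)²∕4)·θ`:
`Σ_q s·(aT b₁ + aT b₂ − aT b₃ − aT b₄)·⟨n̂₀, imVec su2Quat((V^{axialT V c₀})(∂q))⟩`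
`  − [(3∕4)s²Q + θ·d·(sM_L)·(2(4sA_T+4η+θ) + 176·sA_T) + (3∕2)·d·(sM_L)·((8(sA_T)²+2·sA_T·(4η+θ))·(2(4sA_T+4η+θ)) + 30976(sA_T)³)] ≤ A(V) − A(Ψ′V)`.
[cite: Balaban1985Averaging, (10) p.19, (19)-(20) p.21, p.24; Balaban1987RG1, (0.2) p.252] -/
theorem profile_signal_sub_cost_le_wilsonAction4_sub_sweepInv {θ : ℝ} (hθ : 0 ≤ θ)
    {V : GaugeField P k SU2} (hV : PlaqSmall θ V) (c₀ : Site P k) {r : ℕ} (hr : 2 * (r + 2) ≤ P.sitesPerDir k)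
    {n : EuclideanSpace ℝ (Fin 3)} (hn : ‖n‖ = 1)
    (S : Finset (PBond P k)) (hS : ∀ b ∈ S, ∃ z : Fin P.d → ℤ, (∀ ν, (z ν).natAbs ≤ r) ∧ b.src = transl c₀ z)
    (aT : PBond P k → ℝ) (haTS : ∀ b, b ∉ S → aT b = 0) {s A_T M_L Q : ℝ} (hs0 : 0 ≤ s)
    (hAT0 : 0 ≤ A_T) (hAT : ∀ b, |aT b| ≤ A_T) (hML : ∑ b : PBond P k, |aT b| ≤ M_L)
    (hQ : ∑ x : Site P k, ∑ a : Fin P.d, ∑ b : Fin P.d, ((aT ⟨x.shift a, b⟩ - aT ⟨x, b⟩) - (aT ⟨x.shift b, a⟩ - aT ⟨x, a⟩)) ^ 2 ≤ Q)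
    (hsmall : s * A_T ≤ 1 / 4)
    (nf : PBond P k → GaugeField P k SU2 → SU2) (hnf : ∀ b U, nf b U = expPoint ((s * aT b) • adSU2 (axialT U c₀ b.src)⁻¹ n))
    (Ψ' : GaugeField P k SU2 → GaugeField P k SU2) (hΨ' : ∀ U b, Ψ' U b = if b ∈ S then (nf b U)⁻¹ * U b else U b) :
    (∑ q : Plaq P k, s * (aT (bond₁ q) + aT (bond₂ q) - aT (bond₃ q) - aT (bond₄ q)) *
        ⟪n, imVec (su2Quat (GaugeField.plaqHol (GaugeField.gaugeAct (axialT V c₀) V) q))⟫) -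
      (3 / 4 * s ^ 2 * Q +
        θ * P.d * (s * M_L) * (2 * (4 * (s * A_T) + 4 * ((((2 * P.d * (r + 1) + 2 : ℕ) : ℝ) ^ 2 / 4) * θ) + θ) + 176 * (s * A_T)) +
        3 / 2 * P.d * (s * M_L) * ((8 * (s * A_T) ^ 2 + 2 * (s * A_T) * (4 * ((((2 * P.d * (r + 1) + 2 : ℕ) : ℝ) ^ 2 / 4) * θ) + θ)) *
          (2 * (4 * (s * A_T) + 4 * ((((2 * P.d * (r + 1) + 2 : ℕ) : ℝ) ^ 2 / 4) * θ) + θ)) + 30976 * (s * A_T) ^ 3)) ≤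
      wilsonAction4 V - wilsonAction4 (Ψ' V) := by
  -- the signed amplitude and its symbol `s_q`
  set sq : Plaq P k → ℝ := fun q => (if bond₁ q ∈ S then -((fun b => s * aT b) (bond₁ q)) else 0) +
      (if bond₂ q ∈ S then -((fun b => s * aT b) (bond₂ q)) else 0) - (if bond₃ q ∈ S then -((fun b => s * aT b) (bond₃ q)) else 0) -
      (if bond₄ q ∈ S then -((fun b => s * aT b) (bond₄ q)) else 0) with hsq
  -- `|cb| ≤ s·A_T` on `S`, `Σ_S |cb| ≤ s·M_L`
  have hcτ : ∀ b ∈ S, |(fun b => s * aT b) b| ≤ s * A_T := fun b _ => by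
    show |s * aT b| ≤ s * A_T
    rw [abs_mul, abs_of_nonneg hs0]
    exact mul_le_mul_of_nonneg_left (hAT b) hs0
  have hτ0 : 0 ≤ s * A_T := mul_nonneg hs0 hAT0
  have hM : ∑ b ∈ S, |(fun b => s * aT b) b| ≤ s * M_L := by
    show ∑ b ∈ S, |s * aT b| ≤ s * M_L
    calc ∑ b ∈ S, |s * aT b| ≤ ∑ b : PBond P k, |s * aT b| :=
          Finset.sum_le_sum_of_subset_of_nonneg (Finset.subset_univ S) fun b _ _ => abs_nonneg _
      _ = s * ∑ b : PBond P k, |aT b| := by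
          rw [Finset.mul_sum]; exact Finset.sum_congr rfl fun b _ => by rw [abs_mul, abs_of_nonneg hs0]
      _ ≤ s * M_L := mul_le_mul_of_nonneg_left hML hs0
  have hmain := comb_signal_sub_cost_le_wilsonAction4_sub_sweepInv hθ hV c₀ hr hn S hS (fun b => s * aT b) nf hnf Ψ' hΨ'
    hcτ hτ0 hsmall hM sq (fun q => by simp only [hsq])
  -- rewrite the signal and `Σ s_q²` in the profile's letters
  have hs' : ∀ q, sq q = (if bond₁ q ∈ S then -(s * aT (bond₁ q)) else 0) + (if bond₂ q ∈ S then -(s * aT (bond₂ q)) else 0) -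
      (if bond₃ q ∈ S then -(s * aT (bond₃ q)) else 0) - (if bond₄ q ∈ S then -(s * aT (bond₄ q)) else 0) := fun q => by
    simp only [hsq]
  rw [sum_neg_bondSum_mul_eq S aT haTS s _ sq hs', sum_bondSum_sq_eq S aT haTS s sq hs'] at hmain
  have hQ' : 3 / 2 * (s ^ 2 / 2 * ∑ x : Site P k, ∑ a : Fin P.d, ∑ b : Fin P.d,
      ((aT ⟨x.shift a, b⟩ - aT ⟨x, b⟩) - (aT ⟨x.shift b, a⟩ - aT ⟨x, a⟩)) ^ 2) ≤ 3 / 4 * s ^ 2 * Q := by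
    have := mul_le_mul_of_nonneg_left hQ (by positivity : (0 : ℝ) ≤ 3 / 4 * s ^ 2)
    linarith
  linarith

end Summit.QuantumFields.YangMills.Theorems.CovariantDischargeCombSweepProfileGlue

end
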